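import Mathlib
import HarnessLib
import Summits.Langlands.Langlands.Theorems.SkinnerWilesDefectOneReducibleOrdinaryProModularFineSelmerDefs
import Summits.Langlands.Langlands.Theorems.SkinnerWilesDefectOneReducibleOrdinaryProModularPresentationBoundAux
import Literature.NumberTheory.GaloisRepresentations.NearlyOrdinaryDeformationRing
import Literature.NumberTheory.GaloisRepresentations.NearlyOrdinaryPresentation

/-!
# Stub X2 `stub_cmPresentation` ⟸ Böckle's presentation of the universal nearly ordinary deformation ring

Route `SkinnerWilesDefectOne`, crux `ReducibleOrdinaryProModular` (stmt-Langlands-12919), line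
`fine-selmer-codimension-two`, registered stub X2 `stub_cmPresentation`: for an SW-oriented model `M` over an
imaginary quadratic field `F`, `p` odd, a COHEN–MACAULAY PRESENTATION `R_𝒟 ≅ A ⧸ I` of the universal nearly
ordinary deformation ring (`A` complete Noetherian local with an `A`-regular sequence in `𝔪_A` of length
`dim A`, and `4 + μ(I) ≤ dim A`), the common input of Raynaud's theorem (R) and of the margin-one bet (B).

This file pins down EXACTLY what X2 owes to the literature and in which regime, in the format of
`…GrothendieckConnectednessReduction.lean` (stub (R)):

* §1 `Theorems.NearlyOrdinaryPresentation` — the NAMED FACT (statement only, `[cite]`d, to be relocated to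
  `Literature/NumberTheory/GaloisRepresentations/Literature.NumberTheory.GaloisRepresentations.NearlyOrdinaryPresentation.lean`): Böckle's presentation theorem
  for `P`-nearly ordinary deformation rings [Böc07, Thm. 7.6 with Cor. 5.3, Prop. 7.5, Ex. 6.1(a), 6.3], read for
  `G = GL₂`, `P_v` = the Borel subgroup of the residual special line at `v ∣ p`, no fixed determinant, `F` totally
  complex: for a residual datum `𝒟` over a `p`-adic coefficient ring `𝒪` with finite residue field `k` whose
  `ρ̄` has scalar centralizer (`h⁰(G_F, ad ρ̄) = 1`), is `p`-distinguished at every `v ∣ p` (Böckle's (Reg)) and has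
  `h⁰(G_F, ad ρ̄(1)) = 0`, EVERY universal ring `𝓡` of the tree's interface `NearlyOrdinaryDeformationRing 𝒟` is
  `𝒪⟦T₁,…,T_n⟧ ⧸ J` with `n − μ(J) ≥ 1 + [F:ℚ]` (`= h⁰(ad) − h⁰(ad(1)) + Σ_{v∣p} 3[F_v:ℚ_p] − Σ_{v∣∞} 4`).
* §2 `FineSelmerCodimensionTwo.stub_cmPresentation_of_presentation` — the fact implies X2 IN THE REGIME
  `h⁰(G_F, ad ρ̄_𝒟 ⊗ ω̄) = 0` (no matrix `X` with `ω̄(g) ρ̄(g) X = X ρ̄(g)` for all `g` but `X = 0`; explicitly: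
  `χ̄₂ ≠ ω̄ χ̄₁` and `μ_p ⊄ F`), with `A = 𝒪⟦T₁,…,T_n⟧` REGULAR — its maximal ideal is generated by the `A`-regular
  sequence `(ϖ, T₁, …, T_n)` of length `n + 1 = dim A` — and `4 + μ(I) ≤ dim A` from `[F:ℚ] = 2`; and the
  REGISTERED sub-goal alias `stub_cmPresentation_auxOfPresentation` (`<fact written out> → <X2 in that regime>`).

WHY NOT X2 VERBATIM (its regime clause is "the level `S` has a place away from `p`").  Böckle's bound (12)
carries the global obstruction term `−h⁰(G_{F,S}, (ad ρ̄)^∨)`, `(ad)^∨ ≅ ad ρ̄ ⊗ ω̄`, WHATEVER THE LEVEL ([Böc07,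
Rem. 5.4, 7.7]: "technically we are not able to remove it"); for the non-split `ρ̄ = (χ̄₁ ∗; 0 χ̄₂)` with scalar
centralizer it equals `[χ̄₂ = ω̄χ̄₁] + [μ_p ⊂ F]`, so for the shape `(1 ∗; 0 ω̄) ⊗ χ̄₁` (or `p = 3`, `F = ℚ(√−3)`)
the printed margin is `3`, not `4`, at every level.  The level-sensitive count is Kisin's refinement
[Kisin2005, Prop. 4.1.4–4.1.5, Rem. 4.1.7(1)] ("a refinement of a result of Böckle"): in the RELATIVE presentation
over the framed local rings at `Σ = S_p` the global term becomes `dim ker (H⁰(G_{F,S}, ad(1)) → ⊕_{v ∈ S_f ∖ S_p}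
H⁰(G_v, ad(1)))`, zero as soon as `S` has a finite place not above `p` ("(†) … holds if `(S∖Σ)_f` is non-empty").
It is printed for FIXED determinant and the UNRESTRICTED local conditions at `Σ`, as a presentation over
`⊗̂_{v∈Σ} R_v^□`; combined with the obstruction-theoretic presentations over `𝒪` of the framed Borel lifting rings
([Böc07, Thm. 2.2(d), Prop. 7.3–7.5]) and unframing, it WOULD give X2 verbatim (again with `A = 𝒪⟦T⟧` regular), but
that combination — nearly ordinary condition, unfixed determinant, absolute form — is printed nowhere as one theorem,
so it is NOT recorded as a named fact here (lead's call: a synthesis fact, or the regime below).  The Cohen–Macaulay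
route of the skeleton docstring (Böckle's relative presentation [Böc07, Lemma 8.1] over Cohen–Macaulay local rings)
needs the framed Borel lifting rings at `v ∣ p` to be `𝒪`-flat Cohen–Macaulay of relative dimension
`4 + 3[F_v:ℚ_p]` in the OBSTRUCTED cases `χ̄₂|_{G_v} = ω̄χ̄₁|_{G_v}` or `μ_p ⊂ F_v` (implied by, hence no rarer
than, the global obstruction), which is not in print — Snowden [Snowden2018Singularities, §4.2 and Thm. 4.7.2] treats
the residually TRIVIAL local representation only ("We assume for the rest of §4 that `V₀` is trivial"), excluded here
by `p`-distinguishedness — and [Böc07, Lemma 8.1] carries the same global term `h⁰((ad)^∨)` anyway.  So the honest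
reduction to ONE printed theorem is: X2 with the regime clause `∃ v ∈ S, v ∤ p` REPLACED by
`h⁰(G_F, ad ρ̄_𝒟 ⊗ ω̄) = 0` is `NearlyOrdinaryPresentation` + three lines, with `A` regular (no Cohen–Macaulay
theorem at all); the shape `χ̄₂ = ω̄χ̄₁` joins the complement regime, while data of level exactly `S_p` with
`h⁰ = 0` LEAVE it.

References: G. Böckle, *Presentations of universal deformation rings*, in L-functions and Galois representations,
LMS Lecture Note Ser. 320 (2007) 24–58, Thm. 2.2, Cor. 5.3, Rem. 5.4, Ex. 6.1, 6.3, 6.7, §7 (Ex. 7.1, Lemma 7.2–7.4,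
Prop. 7.5, Thm. 7.6) [Bockle2007Presentations]; M. Kisin, *Modularity of 2-dimensional Galois representations*,
Current Developments in Math. 2005, 191–230, Prop. 4.1.4–4.1.5, Rem. 4.1.7 [Kisin2005]; A. Snowden, Math. Z. 288
(2018) = arXiv:1111.3654, §4.2 and Thm. 4.7.2 [Snowden2018Singularities]; J. Tilouine, *Deformations of Galois
representations and Hecke algebras* (1996) (the `P`-nearly ordinary condition); C. Skinner, A. Wiles, Publ. IHÉS 89
(1999) Prop. 2.4 (the totally real analogue `R_𝒟 ≅ 𝒪⟦x₁,…,x_g⟧/(f₁,…,f_r)`) [SkinnerWiles1999]; B. Mazur (1997)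
§20 Prop. 2 [Mazur1997Deformation].
-/

set_option linter.dupNamespace false -- project-wide option (lakefile weak.linter.dupNamespace); `Summit.Langlands.Langlands` is the mandated namespace
set_option autoImplicit false

namespace Summit.Langlands.Langlands.Theorems

open scoped NumberField
open IsDedekindDomain
open Literature.NumberTheory.GaloisRepresentations

/-! ## 1. The named fact: Böckle's presentation theorem for nearly ordinary deformation rings -/

/-- The elements of a list lie in the ideal it generates. [folklore] -/
theorem mem_of_mem_of_ofList_eq {A : Type*} [CommRing A] {rs : List A} {J : Ideal A}
    (h : Ideal.ofList rs = J) {r : A} (hr : r ∈ rs) : r ∈ J :=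
  h ▸ Ideal.subset_span hr

/-- The margin arithmetic: `μ + 1 + d ≤ n`, `d = 2`, `|rs| = n + 1` give `4 + μ ≤ |rs|` in `WithBot ℕ∞`.
[folklore] -/
theorem four_add_le_of_margin {μ d n len : ℕ} (h : μ + 1 + d ≤ n) (hd : d = 2) (hlen : len = n + 1) :
    ((4 : ℕ) : WithBot ℕ∞) + (μ : WithBot ℕ∞) ≤ (len : WithBot ℕ∞) := by
  have h' : 4 + μ ≤ len := by omega
  exact_mod_cast h'

end Summit.Langlands.Langlands.Theorems

/-! ## 3. The registered sub-goal: X2 (regime `h⁰(G_F, ad ρ̄(1)) = 0`) from the named fact -/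

namespace Summit.Langlands.Langlands.Cruxes.ReducibleOrdinaryProModular.FineSelmerCodimensionTwo

open scoped NumberField MatrixGroups
open Filter NumberField IsDedekindDomain Field Matrix
open Literature.NumberTheory.GaloisRepresentations
open Summit.Langlands.Langlands.Theses.SkinnerWilesDefectOne
open Summit.Langlands.Langlands.Cruxes.ReducibleOrdinaryProModular.SteinbergHyperplane
open Summit.Langlands.Langlands.Theorems

/-- **X2 in the regime `h⁰(G_F, ad ρ̄_𝒟 ⊗ ω̄) = 0`, from Böckle's presentation theorem.**  For an SW-oriented
model `M` over an imaginary quadratic `F`, `p` odd, whose residual datum has no non-zero matrix `X` with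
`ω̄(g)·ρ̄(g) X = X ρ̄(g)` for all `g ∈ G_F` (i.e. `χ̄₂ ≠ ω̄χ̄₁` and `μ_p ⊄ F`): `R_𝒟 ≅ A ⧸ I` with `A` complete
Noetherian local having an `A`-regular sequence in `𝔪_A` of length `dim A` and `4 + μ(I) ≤ dim A` — the binders of
the registered stub `stub_cmPresentation` verbatim, except that its level clause `∃ v ∈ M.𝒟.S, v ∤ p` is replaced
by the vanishing of `H⁰(G_F, ad ρ̄_𝒟(1))` (the printed regime).  Proof: `NearlyOrdinaryPresentation` at
`(F, p, M.𝒪, M.k, M.𝒟, M.𝓡)` gives `A ≅ 𝒪⟦T₁,…,T_n⟧`, `𝔪_A = (rs)` with `rs` regular of length `n + 1 = dim A`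
and `μ(I) + 1 + [F:ℚ] ≤ n`; with `[F:ℚ] = 2` this is `4 + μ(I) ≤ n + 1 = dim A`.
[cite: Bockle2007Presentations, Theorem 7.6 and Corollary 5.3] -/
theorem stub_cmPresentation_of_presentation (hP : Literature.NumberTheory.GaloisRepresentations.NearlyOrdinaryPresentation) :
    ∀ (F : Type) [Field F] [NumberField F], IsTotallyComplex F → Module.finrank ℚ F = 2 →
      ∀ (p : ℕ) [Fact p.Prime], p ≠ 2 →
      ∀ M : ModelData F p, M.IsSWOriented p →
        (∀ X : Matrix (Fin 2) (Fin 2) M.k,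
          (∀ g : absoluteGaloisGroup F,
            (ZMod.castHom (dvd_refl p) M.k
                (PadicInt.toZMod ((GaloisRep.cyclotomicCharacter F p g : ℤ_[p]ˣ) : ℤ_[p]))) •
              ((M.𝒟.residual g).val * X) = X * (M.𝒟.residual g).val) → X = 0) →
        (∃ (A : Type) (_ : CommRing A) (_ : IsNoetherianRing A) (_ : IsLocalRing A)
            (_ : IsAdicComplete (IsLocalRing.maximalIdeal A) A) (rs : List A) (I : Ideal A) (_ : M.𝓡.R ≃+* A ⧸ I),
            (∀ r ∈ rs, r ∈ IsLocalRing.maximalIdeal A) ∧ RingTheory.Sequence.IsRegular A rs ∧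
              (rs.length : WithBot ℕ∞) = ringKrullDim A ∧ ((4 : ℕ) : WithBot ℕ∞) + I.spanFinrank ≤ ringKrullDim A) := by
  intro F _ _ hF hdeg p _ _ M hM hH0
  obtain ⟨A, iA, iN, iL, iC, iAlg, n, -, rs, I, e, hgen, hreg, hlen, hdim, hle⟩ :=
    hP F hF p M.𝒪 M.k M.𝒟 hM.hasScalarCentralizer hM.isDistinguishedAt hH0 M.𝓡
  refine ⟨A, iA, iN, iL, iC, rs, I, e.toRingEquiv, fun r hr => mem_of_mem_of_ofList_eq hgen hr, hreg, hdim, ?_⟩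
  rw [← hdim]
  exact four_add_le_of_margin hle hdeg hlen

/-- **Registered sub-goal `stub_cmPresentation_auxOfPresentation` of stub X2 `stub_cmPresentation` (line
`fine-selmer-codimension-two`, crux stmt-Langlands-12919): Böckle's presentation theorem (the named fact
`NearlyOrdinaryPresentation`, written out) implies X2 in the regime `h⁰(G_F, ad ρ̄_𝒟(1)) = 0`**
(`stub_cmPresentation_of_presentation`, definitional unfolding). [cite: Bockle2007Presentations, Theorem 7.6 and Corollary 5.3] -/
theorem stub_cmPresentation_auxOfPresentation :
    (∀ (F : Type) [Field F] [NumberField F], NumberField.IsTotallyComplex F →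
      ∀ (p : ℕ) [Fact p.Prime] (𝒪 : Type) [CommRing 𝒪] [IsDomain 𝒪] [IsDiscreteValuationRing 𝒪]
        [CharZero 𝒪] [IsAdicComplete (IsLocalRing.maximalIdeal 𝒪) 𝒪]
        (k : Type) [Field k] [Finite k] [CharP k p] [Algebra 𝒪 k]
        (𝒟 : NearlyOrdinaryDatum F p 𝒪 k),
        𝒟.HasScalarCentralizer →
        (∀ v : IsDedekindDomain.HeightOneSpectrum (NumberField.RingOfIntegers F),
          (p : NumberField.RingOfIntegers F) ∈ v.asIdeal → 𝒟.IsDistinguishedAt v) →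
        (∀ X : Matrix (Fin 2) (Fin 2) k,
          (∀ g : Field.absoluteGaloisGroup F,
            (ZMod.castHom (dvd_refl p) k
                (PadicInt.toZMod ((GaloisRep.cyclotomicCharacter F p g : ℤ_[p]ˣ) : ℤ_[p]))) •
              ((𝒟.residual g).val * X) = X * (𝒟.residual g).val) → X = 0) →
        ∀ 𝓡 : NearlyOrdinaryDeformationRing.{0} 𝒟,
          ∃ (A : Type) (_ : CommRing A) (_ : IsNoetherianRing A) (_ : IsLocalRing A)
            (_ : IsAdicComplete (IsLocalRing.maximalIdeal A) A) (_ : Algebra 𝒪 A) (n : ℕ)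
            (_ : A ≃ₐ[𝒪] MvPowerSeries (Fin n) 𝒪) (rs : List A) (I : Ideal A) (_ : 𝓡.R ≃ₐ[𝒪] A ⧸ I),
            Ideal.ofList rs = IsLocalRing.maximalIdeal A ∧ RingTheory.Sequence.IsRegular A rs ∧
              rs.length = n + 1 ∧ (rs.length : WithBot ℕ∞) = ringKrullDim A ∧
              I.spanFinrank + 1 + Module.finrank ℚ F ≤ n) →
    ∀ (F : Type) [Field F] [NumberField F], IsTotallyComplex F → Module.finrank ℚ F = 2 →
      ∀ (p : ℕ) [Fact p.Prime], p ≠ 2 →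
      ∀ M : ModelData F p, M.IsSWOriented p →
        (∀ X : Matrix (Fin 2) (Fin 2) M.k,
          (∀ g : absoluteGaloisGroup F,
            (ZMod.castHom (dvd_refl p) M.k
                (PadicInt.toZMod ((GaloisRep.cyclotomicCharacter F p g : ℤ_[p]ˣ) : ℤ_[p]))) •
              ((M.𝒟.residual g).val * X) = X * (M.𝒟.residual g).val) → X = 0) →
        (∃ (A : Type) (_ : CommRing A) (_ : IsNoetherianRing A) (_ : IsLocalRing A)
            (_ : IsAdicComplete (IsLocalRing.maximalIdeal A) A) (rs : List A) (I : Ideal A) (_ : M.𝓡.R ≃+* A ⧸ I),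
            (∀ r ∈ rs, r ∈ IsLocalRing.maximalIdeal A) ∧ RingTheory.Sequence.IsRegular A rs ∧
              (rs.length : WithBot ℕ∞) = ringKrullDim A ∧ ((4 : ℕ) : WithBot ℕ∞) + I.spanFinrank ≤ ringKrullDim A) :=
  fun h => stub_cmPresentation_of_presentation h

end Summit.Langlands.Langlands.Cruxes.ReducibleOrdinaryProModular.FineSelmerCodimensionTwo
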